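import Literature.NumberTheory.LFunctions.KMVFirstMomentBeyondDiagonal
import Literature.NumberTheory.LFunctions.KowalskiMichelPeterssonBoundWeilFree
import Literature.NumberTheory.EllipticCurves.TwistedLValueSeries
import Literature.NumberTheory.LFunctions.Bettin2017CentralValueDampedTwist
import Literature.NumberTheory.LFunctions.Bettin2017HarmonicDampedTwist
import Literature.NumberTheory.LFunctions.Bettin2017DualTail
import Literature.NumberTheory.LFunctions.Bettin2017OffDiagonal
import Literature.NumberTheory.LFunctions.Bettin2017LargeShiftPetersson
import Literature.NumberTheory.LFunctions.KowalskiMichelPeterssonFormulaHolds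
import Summits.Parity.GeneralizedHardyLittlewood.Theses.PrimeLevelFamEdge
import HarnessLib

/-!
# FACT SKELETON for input I2 = `bettin2017_theorem11_primeLevel`
# (Bettin 2017, Thm. 1.1 at prime level `N`, weight `2`, trivial twist, no shift)

Line `hecke_afe_petersson` (cell landau-siegel / ls-inputs, D-0154 (2) «INPUTS → UNCONDITIONAL»).

TARGET (tree, `Literature/NumberTheory/LFunctions/KMVFirstMomentBeyondDiagonal.lean:115`):
`bettin2017_theorem11_primeLevel : ∀ ε > 0 ∃ C N₀ ∀ prime N ≥ N₀ ∀ m ≥ 1,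
  ‖Σ^h_{f ∈ S_2(N)^*} λ_f(m) L(½,f) − m^{-1/2}‖ ≤ C m^{1/2} N^{-1+ε}`
[Bettin2017, Thm. 1.1 (p. 3), case ν = 1, k = 2, χ = 1, α = 0; proof §2 (2.1)–(2.5), §§3–4].

THE LINE. Bettin's proof (§2) is: approximate functional equation for `L(½, f)` (Lemma 2.1) →
Petersson's formula (Lemma 2.2) → diagonal `m^{-1/2} V(m/Y)` + off-diagonal
`Σ_n n^{-1/2} V(n/Y) J_N(m, n)` (2.3) → the off-diagonal is `≪ m^{1/2} N^{-1+ε}` by opening the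
Kloosterman sums and using the functional equation of the periodic ("twisted periodic", `q = 1`)
zeta function `F(s, a/c) = Σ e(na/c) n^{-s}` (Lemma 3.1, Cor. 3.1) in a Mellin–Barnes integral for
`J₁` (§4). We run it with ONE change that the tree makes free: instead of the one-sided smoothed
AFE with `V(x) = (2πi)⁻¹∫ e^{s²} x^{-s} ds/s` and an `O(N^{-A})` error, we use the EXACT weight-2
two-sided formula ("Hecke's trick", in the tree as `modularSymbol_eq_rayTail_sub`):
`L(½, f) = D_f(y) − ε_f D_f(1/(Ny))`, `D_f(y) = Σ_{n ≥ 1} a_f(n) e^{-2πny}/n = Σ λ_f(n) n^{-1/2} e^{-2πny}`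
(`dampedTwist f 1 y`), valid for every `y > 0` and every `w_N`-eigenform `f` (`ε_f = frickeEigenvalue f
= ±1` for `f ∈ newforms0 N 2`). With the UNBALANCED choice `y = 1/(m N²)` (Bettin's `Y = (mN)²`
plays the same role) the dual piece `D_f(mN)` is exponentially small (`e^{-2π m N}`), the diagonal is
`m^{-1/2} e^{-2π/N²} = m^{-1/2} + O(m^{1/2} N^{-2})`, and what is left is EXACTLY Bettin's
off-diagonal with the cutoff `V(x) = e^{-2πx}` (whose Mellin transform `(2π)^{-w} Γ(w)` serves §4
verbatim: no pole in `re w > 0`, Stirling decay).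

STUBS (sorries ONLY here; signatures over existing tree decls, no new definition;
STATUS 2026-08-28T09:00Z: S1 LANDED p608850, S2 LANDED p610129 (w1), S4 LANDED p612394 (lead), S5 LANDED
p610928 (w2); kernel composition landed as `Bettin2017FirstMomentPrimeLevel.lean` (p613437:
`firstMoment_sub_le_of_petersson : I1 → ∀B, Thm 1.1 for m ≤ N^B`); S6 (regime m ≥ N^B) LANDED
DELIGNE-FREE p618506 (w2 g2) = `Bettin2017LargeShiftPetersson.lean`, `largeShift_of_petersson : I1 → S6`
(B = 24; Weil + `|J₁(x)| ≤ min(1, x/2) ≤ (x/2)^{3/4}` give `‖J_N(m,n)‖ ≪ √(m,n)(mn)^{3/8}N^{-5/4}`, and the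
exact formula at height 1/N) and the END RESULT `bettin2017_theorem11_primeLevel_of_petersson : I1 → I2`
— so below `stub_largeShift := largeShift_of_petersson stub_petersson`; and (v4, 2026-08-28T09:35Z)
S3 = I1 is LANDED p621287 (`KowalskiMichel2000.kowalskiMichel2000_peterssonFormula_holds`, I1 cell, line
`poincare-hecke`), so `stub_petersson := …_holds` and this skeleton has NO sorry left; the fact is discharged
in the tree as `bettin2017_theorem11_primeLevel_holds` (p621630, `Bettin2017PrimeLevelHolds.lean`) and the
crux closed by `Summit.Parity.GeneralizedHardyLittlewood.Theorems.FirstMomentPrinted_proof` (p621700)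
(the older conditional route via Deligne, `Bettin2017LargeShift.lean` p615553, is superseded):
* `stub_centralValue_eq_dampedTwist_sub` — the exact two-sided formula for `L(½,f)`,
  `f ∈ newforms0 N 2` [Hecke; tree: `modularSymbol_eq_rayTail_sub` + `modularSymbol_zero_eq_holds`
  + `centralValue_eq` + `isFrickeEigen_of_frickeInvolution_eq_smul` +
  `IsNewform0.frickeInvolution_eq_smul_holds`]. SIZE S — FIRST RUNG.
* `stub_harmonicSum_dampedTwist` — `Σ^h_f λ_f(m) D_f(y) = Σ_n n^{-1/2} e^{-2πny} Σ^h_f λ_f(m)λ_f(n)`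
  (finite harmonic sum through an absolutely convergent `n`-sum; `a_f(n)/n = λ_f(n) n^{-1/2}`).
  SIZE S — FIRST RUNG.
* `stub_petersson` — Petersson's formula at prime level, weight 2 = input I1
  (`KowalskiMichel2000.kowalskiMichel2000_peterssonFormula`, Kowalski–Michel 2000 §2.4.2 = Bettin
  Lemma 2.2 = IK (14.59)). SIZE XL (Poincaré series on `Γ₀(N)`; see INPUT-LIST-v1 I1).
* `stub_offDiagonal` — Bettin (2.3)–(2.5) + §3 + §4 at `q = 1`, `α = 0`, cutoff `e^{-2πn/(mN²)}`:
  `‖Σ_n n^{-1/2} e^{-2πn/(mN²)} J_N(m,n)‖ ≤ C m^{1/2} N^{-1+ε}` for `1 ≤ m ≤ N^B` (every fixed `B`;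
  the `m ≤ N^B` proviso is Bettin's «we assume m ≪ N^{100}», p. 5, which absorbs the `(Yc)^ε`
  losses of (4.3)). Infrastructure: Weil's bound (tree, `weil_kloosterman_bound_holds`), the
  periodic/Hurwitz zeta functional equation (MATHLIB: `HurwitzZeta.expZeta`, `hurwitzZeta_one_sub`,
  `expZeta_one_sub`…), Phragmén–Lindelöf (Mathlib `PhragmenLindelof.vertical_strip`) for Cor. 3.1,
  a Mellin–Barnes representation of `J₁` (tree `besselJ`: MISSING, to be proved) and vertical
  Stirling for `Γ(s/2)/Γ((2-s)/2)·Γ(w)` (partly in tree: `norm_Gamma_half_sub_sq`; MISSING in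
  general). SIZE L. THE HARDEST STUB.
* `stub_dualTail` — GIVEN Petersson's formula: the `ε_f`-piece
  `Σ^h ε_f λ_f(m) D_f(mN)` is `≤ C m^{1/2} N^{-2}` (route: `ε_f = −a_f(N)` for `N` prime
  [Atkin–Lehner Thm. 3; tree `IsNewform0.frickeEigenvalue_eq_prod_atkinLehnerEigenvalueAt_holds`],
  `a_f(N) a_f(n) = a_f(Nn)` [tree `IsNewform0.cuspCoeff_prime_mul`], so the piece is
  `−Σ_n e^{-2πnmN} n^{-1} (Nn)^{1/2} Σ^h λ_f(m)λ_f(Nn)`, and `|Σ^h λ_f(m)λ_f(Nn)| ≤ δ + |J_N(m,Nn)|`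
  with the tree's all-range bound `norm_petKloostermanTerm_le_all`). SIZE M — FIRST RUNG.
* `stub_largeShift` — the regime `m ≥ N^B` («otherwise the result is trivial», p. 5): needs the
  Ramanujan–Petersson bound `|λ_f(m)| ≤ τ(m)` for weight-2 newforms [Deligne1974, Thm. 8.2;
  weight 2: Eichler–Shimura–Igusa] — NOT in Mathlib or the tree — plus a crude bound
  `Σ^h |L(½,f)| ≪ N^{1/4+ε}` (from the first two stubs + Deligne). SIZE M given Deligne as a named
  fact; the consumers of I2 (`KMV2000.firstDisplay_of_bettin`, crux K_B) only ever use `m < N`.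

KERNEL COMPOSITION `bettin2017_theorem11_primeLevel_of` (proved below, no sorry): case split at
`m = N^B`; below it, (exact AFE inside the harmonic sum) − (dual tail) = Σ_n w(n)·Σ^h λλ =
`w(m) − Σ_n w(n) J_N(m,n)` by Petersson, `|w(m) − m^{-1/2}| ≤ 2π m^{1/2} N^{-2}`, and the three
errors add up to `(2π + |C₄| + |C₅|) m^{1/2} N^{-1+ε}`.

«The programme SEARCHES and TYPES; no claim about Landau–Siegel zeros, Theorems 1–2 of
arXiv:2211.02515 or a repaired Margin232 until a kernel theorem says so.»
-/

noncomputable section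

open scoped Real
open Complex CongruenceSubgroup
open Literature.NumberTheory.EllipticCurves.ModularForms

namespace Literature.NumberTheory.LFunctions.Bettin2017

/-! ## The stubs -/

/-- **Stub 1 (exact two-sided central-value formula, weight 2).** For `f ∈ newforms0 N 2` and every
`y > 0`: `L(½, f) = D_f(y) − ε_f · D_f(1/(N y))`, `D_f(y) = Σ_{n≥1} a_f(n) e^{-2πny}/n`
(`dampedTwist f 1 y`), `ε_f = frickeEigenvalue f`. Hecke's splitting of `Λ(f,1) = ∫_0^∞ f(it) dt` at
height `y` and the flip `t ↦ 1/(Nt)`; in the tree this is `modularSymbol_eq_rayTail_sub` at the cusp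
`0 = 0/1` plus `{∞,0}_f = L(f,1)` (`modularSymbol_zero_eq_holds`) and `centralValue_eq`.
[cite: Bettin2017, Lemma 2.1 (the role it plays); exact form: Cremona 1997 §2.10–§2.11] -/
theorem stub_centralValue_eq_dampedTwist_sub :
    ∀ (N : ℕ) [NeZero N] (f : CuspForm (Gamma0 N) 2), f ∈ newforms0 N 2 → ∀ y : ℝ, 0 < y →
      IwaniecSarnak.centralValue f =
        dampedTwist f (fun _ ↦ 1) y -
          frickeEigenvalue f * dampedTwist f (fun _ ↦ 1) (1 / ((N : ℝ) * y)) :=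
  -- LANDED p608850 (lead): `Bettin2017CentralValueDampedTwist.lean`
  centralValue_eq_dampedTwist_sub_all

/-- **Stub 2 (the harmonic sum through the `n`-series).** For every level `N`, `m : ℕ`, `y > 0`:
`Σ^h_f λ_f(m) D_f(y) = Σ_{n} n^{-1/2} e^{-2πny} · Σ^h_f λ_f(m) λ_f(n)` (`= Σ_n w_y(n) · pet N m n`),
the `n`-series converging absolutely; uses `a_f(n) = λ_f(n) n^{1/2}` and the finiteness of
`newforms0 N 2`. [cite: Bettin2017, §2 (2.3), first line] -/
theorem stub_harmonicSum_dampedTwist :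
    ∀ (N : ℕ) [NeZero N] (m : ℕ) (y : ℝ), 0 < y →
      Summable (fun n : ℕ ↦
        ‖(((n : ℝ) ^ (-(1 / 2 : ℝ)) * Real.exp (-(2 * Real.pi * n) * y) : ℝ) : ℂ) *
          KowalskiMichel2000.pet N m n‖) ∧
      GL2Family.harmonicSum N 2
          (fun f ↦ GL2Family.heckeLambda f m * dampedTwist f (fun _ ↦ 1) y) =
        ∑' n : ℕ, (((n : ℝ) ^ (-(1 / 2 : ℝ)) * Real.exp (-(2 * Real.pi * n) * y) : ℝ) : ℂ) *
          KowalskiMichel2000.pet N m n :=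
  -- LANDED p610129 (w1): `Bettin2017HarmonicDampedTwist.lean`
  harmonicSum_heckeLambda_mul_dampedTwist_all

/-- **Stub 3 (Petersson's formula, prime level, weight 2) = input I1.** Kowalski–Michel 2000,
§2.4.2 p. 312: `Σ^h_f λ_f(l₁)λ_f(l₂) = δ(l₁,l₂) − J(l₁,l₂)`; Bettin's Lemma 2.2; Iwaniec–Kowalski
(14.59). The tree's named fact, taken verbatim. [cite: KowalskiMichel2000, §2.4.2 p. 312]
[cite: Bettin2017, Lemma 2.2] -/
theorem stub_petersson : KowalskiMichel2000.kowalskiMichel2000_peterssonFormula :=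
  -- LANDED p621287 (I1 cell: lead g0 + w1 g2 + w2 g2 + w3 g0): `KowalskiMichelPeterssonFormulaHolds.lean`
  KowalskiMichel2000.kowalskiMichel2000_peterssonFormula_holds

/-- **Stub 4 (the off-diagonal, Bettin §2 (2.3)–(2.5) + §3 Lemma 3.1/Cor. 3.1 + §4).** For every
`B` and `ε > 0` there are `C, N₀` with
`‖Σ_n n^{-1/2} e^{-2πn/(mN²)} J_N(m,n)‖ ≤ C m^{1/2} N^{-1+ε}` for all primes `N ≥ N₀` and
`1 ≤ m ≤ N^B` (`J_N = KowalskiMichel2000.petJ N`). Printed route: Weil's bound for the tail `c > N^D`,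
then open `S(m,n;c)`, Mellin–Barnes for `J₁`, and the functional equation + convexity bound of the
periodic zeta function `F(s, a/c)` (`c ∤ 1`: entire). [cite: Bettin2017, §2 (2.3)–(2.5), §3, §4] -/
theorem stub_offDiagonal :
    ∀ B : ℕ, ∀ ε : ℝ, 0 < ε → ∃ C : ℝ, ∃ N₀ : ℕ, ∀ (N : ℕ) [NeZero N], N.Prime → N₀ ≤ N →
      ∀ m : ℕ, 1 ≤ m → (m : ℝ) ≤ (N : ℝ) ^ B →
        ‖∑' n : ℕ, (((n : ℝ) ^ (-(1 / 2 : ℝ)) *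
              Real.exp (-(2 * Real.pi * n) * (1 / ((m : ℝ) * (N : ℝ) ^ 2))) : ℝ) : ℂ) *
            KowalskiMichel2000.petJ N m n‖ ≤
          C * (m : ℝ) ^ (1 / 2 : ℝ) * (N : ℝ) ^ (-1 + ε) :=
  -- LANDED p612394 (lead): `Bettin2017OffDiagonal.lean` (chain p609706 → p610238 → p611234 → p611652)
  offDiagonal_le

/-- **Stub 5 (the dual piece is negligible), GIVEN Petersson's formula.** There are `C, N₀` with
`‖Σ^h_f ε_f λ_f(m) D_f(mN)‖ ≤ C m^{1/2} N^{-2}` for all primes `N ≥ N₀`, `m ≥ 1` (the dual cutoff is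
`e^{-2πnmN}`; route: `ε_f = −a_f(N)`, `a_f(N)a_f(n) = a_f(Nn)`, Petersson + the all-range
Kloosterman–Bessel bound of the tree). [cite: Bettin2017, Lemma 2.1 (the discarded dual integral)] -/
theorem stub_dualTail :
    KowalskiMichel2000.kowalskiMichel2000_peterssonFormula →
      ∃ C : ℝ, ∃ N₀ : ℕ, ∀ (N : ℕ) [NeZero N], N.Prime → N₀ ≤ N → ∀ m : ℕ, 1 ≤ m →
        ‖GL2Family.harmonicSum N 2
            (fun f ↦ frickeEigenvalue f * GL2Family.heckeLambda f m *
              dampedTwist f (fun _ ↦ 1) ((m : ℝ) * N))‖ ≤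
          C * (m : ℝ) ^ (1 / 2 : ℝ) * (N : ℝ) ^ (-(2 : ℝ)) :=
  -- LANDED p610928 (w2): `Bettin2017DualTail.lean`
  dualTail_of_peterssonFormula

/-- **Stub 6 (the regime `m ≥ N^B`: «we assume m ≪ N^{100}, otherwise the result is trivial»,
Bettin p. 5).** There is `B` such that for every `ε > 0` there are `C, N₀` with the target bound for
all primes `N ≥ N₀` and all `m ≥ N^B`. DISCHARGED from Stub 3 (Petersson) alone, WITHOUT the
Ramanujan–Petersson bound: the exact formula at height `1/N`, Petersson termwise, and the
Kloosterman–Bessel bound `‖J_N(m,n)‖ ≪ √(m,n) (mn)^{3/8} N^{-5/4}` (Weil + `|J₁(x)| ≤ (x/2)^{3/4}`),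
tree `Bettin2017.largeShift_of_petersson` (p618506, `B = 24`). The consumers of I2 use only `m < N`.
[cite: Bettin2017, §2 (p. 5, first paragraph)] -/
theorem stub_largeShift :
    ∃ B : ℕ, ∀ ε : ℝ, 0 < ε → ∃ C : ℝ, ∃ N₀ : ℕ, ∀ (N : ℕ) [NeZero N], N.Prime → N₀ ≤ N →
      ∀ m : ℕ, (N : ℝ) ^ B ≤ m →
        ‖GL2Family.harmonicSum N 2
              (fun f ↦ GL2Family.heckeLambda f m * IwaniecSarnak.centralValue f) -
            (((m : ℝ) ^ (-(1 / 2 : ℝ)) : ℝ) : ℂ)‖ ≤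
          C * (m : ℝ) ^ (1 / 2 : ℝ) * (N : ℝ) ^ (-1 + ε) :=
  -- LANDED p618506 (w2 g2): `Bettin2017LargeShiftPetersson.lean` — from Stub 3 (I1) alone
  largeShift_of_petersson stub_petersson

/-! ## Kernel glue -/

/-- `1 − e^{−x} ≤ x` for `0 ≤ x`. [folklore] -/
private theorem one_sub_exp_neg_le (x : ℝ) : 1 - Real.exp (-x) ≤ x := by
  have h := Real.add_one_le_exp (-x)
  linarith

/-- The diagonal weight at `n = m`: `|m^{-1/2} e^{-2π m y} − m^{-1/2}| ≤ 2π m^{1/2} y` for `m ≥ 1`,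
`y ≥ 0`. [folklore] -/
private theorem norm_diag_sub_le {m : ℕ} (hm : 1 ≤ m) {y : ℝ} (hy : 0 ≤ y) :
    ‖(((m : ℝ) ^ (-(1 / 2 : ℝ)) * Real.exp (-(2 * Real.pi * m) * y) : ℝ) : ℂ) -
        (((m : ℝ) ^ (-(1 / 2 : ℝ)) : ℝ) : ℂ)‖ ≤
      2 * Real.pi * (m : ℝ) ^ (1 / 2 : ℝ) * y := by
  have hm0 : (0 : ℝ) < m := by exact_mod_cast hm
  have hm1 : (1 : ℝ) ≤ m := by exact_mod_cast hm
  rw [← Complex.ofReal_sub, Complex.norm_real, Real.norm_eq_abs]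
  have hx : (0 : ℝ) ≤ 2 * Real.pi * m * y := by positivity
  have he1 : Real.exp (-(2 * Real.pi * m) * y) ≤ 1 := by
    rw [Real.exp_le_one_iff]; linarith
  have he2 : 1 - Real.exp (-(2 * Real.pi * m) * y) ≤ 2 * Real.pi * m * y := by
    have := one_sub_exp_neg_le (2 * Real.pi * m * y)
    rwa [show -(2 * Real.pi * m * y) = -(2 * Real.pi * m) * y by ring] at this
  have hr0 : 0 ≤ (m : ℝ) ^ (-(1 / 2 : ℝ)) := Real.rpow_nonneg hm0.le _
  rw [show (m : ℝ) ^ (-(1 / 2 : ℝ)) * Real.exp (-(2 * Real.pi * m) * y) - (m : ℝ) ^ (-(1 / 2 : ℝ)) =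
      -((m : ℝ) ^ (-(1 / 2 : ℝ)) * (1 - Real.exp (-(2 * Real.pi * m) * y))) by ring,
    abs_neg, abs_of_nonneg (mul_nonneg hr0 (by linarith))]
  -- `m^{-1/2} · 2π m y = 2π m^{1/2} y`
  have hpow : (m : ℝ) ^ (-(1 / 2 : ℝ)) * m = (m : ℝ) ^ (1 / 2 : ℝ) := by
    rw [show (m : ℝ) ^ (-(1 / 2 : ℝ)) * m = (m : ℝ) ^ (-(1 / 2 : ℝ)) * (m : ℝ) ^ (1 : ℝ) by
        rw [Real.rpow_one], ← Real.rpow_add hm0]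
    norm_num
  calc (m : ℝ) ^ (-(1 / 2 : ℝ)) * (1 - Real.exp (-(2 * Real.pi * m) * y))
      ≤ (m : ℝ) ^ (-(1 / 2 : ℝ)) * (2 * Real.pi * m * y) :=
        mul_le_mul_of_nonneg_left he2 hr0
    _ = 2 * Real.pi * ((m : ℝ) ^ (-(1 / 2 : ℝ)) * m) * y := by ring
    _ = 2 * Real.pi * (m : ℝ) ^ (1 / 2 : ℝ) * y := by rw [hpow]

/-- **KERNEL COMPOSITION.** The six stubs imply `bettin2017_theorem11_primeLevel` (Bettin 2017,
Thm. 1.1 at prime level, weight 2, no twist, no shift), with `C = max C₆ (2π + |C₄| + |C₅|)`.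
[cite: Bettin2017, Thm. 1.1 and §2] -/
theorem bettin2017_theorem11_primeLevel_of
    (h1 : ∀ (N : ℕ) [NeZero N] (f : CuspForm (Gamma0 N) 2), f ∈ newforms0 N 2 → ∀ y : ℝ, 0 < y →
      IwaniecSarnak.centralValue f =
        dampedTwist f (fun _ ↦ 1) y -
          frickeEigenvalue f * dampedTwist f (fun _ ↦ 1) (1 / ((N : ℝ) * y)))
    (h2 : ∀ (N : ℕ) [NeZero N] (m : ℕ) (y : ℝ), 0 < y →
      Summable (fun n : ℕ ↦
        ‖(((n : ℝ) ^ (-(1 / 2 : ℝ)) * Real.exp (-(2 * Real.pi * n) * y) : ℝ) : ℂ) *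
          KowalskiMichel2000.pet N m n‖) ∧
      GL2Family.harmonicSum N 2
          (fun f ↦ GL2Family.heckeLambda f m * dampedTwist f (fun _ ↦ 1) y) =
        ∑' n : ℕ, (((n : ℝ) ^ (-(1 / 2 : ℝ)) * Real.exp (-(2 * Real.pi * n) * y) : ℝ) : ℂ) *
          KowalskiMichel2000.pet N m n)
    (h3 : KowalskiMichel2000.kowalskiMichel2000_peterssonFormula)
    (h4 : ∀ B : ℕ, ∀ ε : ℝ, 0 < ε → ∃ C : ℝ, ∃ N₀ : ℕ, ∀ (N : ℕ) [NeZero N], N.Prime → N₀ ≤ N →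
      ∀ m : ℕ, 1 ≤ m → (m : ℝ) ≤ (N : ℝ) ^ B →
        ‖∑' n : ℕ, (((n : ℝ) ^ (-(1 / 2 : ℝ)) *
              Real.exp (-(2 * Real.pi * n) * (1 / ((m : ℝ) * (N : ℝ) ^ 2))) : ℝ) : ℂ) *
            KowalskiMichel2000.petJ N m n‖ ≤
          C * (m : ℝ) ^ (1 / 2 : ℝ) * (N : ℝ) ^ (-1 + ε))
    (h5 : KowalskiMichel2000.kowalskiMichel2000_peterssonFormula →
      ∃ C : ℝ, ∃ N₀ : ℕ, ∀ (N : ℕ) [NeZero N], N.Prime → N₀ ≤ N → ∀ m : ℕ, 1 ≤ m →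
        ‖GL2Family.harmonicSum N 2
            (fun f ↦ frickeEigenvalue f * GL2Family.heckeLambda f m *
              dampedTwist f (fun _ ↦ 1) ((m : ℝ) * N))‖ ≤
          C * (m : ℝ) ^ (1 / 2 : ℝ) * (N : ℝ) ^ (-(2 : ℝ)))
    (h6 : ∃ B : ℕ, ∀ ε : ℝ, 0 < ε → ∃ C : ℝ, ∃ N₀ : ℕ, ∀ (N : ℕ) [NeZero N], N.Prime → N₀ ≤ N →
      ∀ m : ℕ, (N : ℝ) ^ B ≤ m →
        ‖GL2Family.harmonicSum N 2
              (fun f ↦ GL2Family.heckeLambda f m * IwaniecSarnak.centralValue f) -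
            (((m : ℝ) ^ (-(1 / 2 : ℝ)) : ℝ) : ℂ)‖ ≤
          C * (m : ℝ) ^ (1 / 2 : ℝ) * (N : ℝ) ^ (-1 + ε)) :
    bettin2017_theorem11_primeLevel := by
  intro ε hε
  obtain ⟨B, hB⟩ := h6
  obtain ⟨C₆, N₆, H₆⟩ := hB ε hε
  obtain ⟨C₄, N₄, H₄⟩ := h4 B ε hε
  obtain ⟨C₅, N₅, H₅⟩ := h5 h3
  refine ⟨max C₆ (2 * Real.pi + |C₄| + |C₅|), max (max N₆ N₄) (max N₅ 2),
    fun N _ hN hN₀ m hm ↦ ?_⟩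
  have hN₆ : N₆ ≤ N := le_trans (le_trans (le_max_left _ _) (le_max_left _ _)) hN₀
  have hN₄ : N₄ ≤ N := le_trans (le_trans (le_max_right _ _) (le_max_left _ _)) hN₀
  have hN₅ : N₅ ≤ N := le_trans (le_trans (le_max_left _ _) (le_max_right _ _)) hN₀
  have hN2 : 2 ≤ N := le_trans (le_trans (le_max_right _ _) (le_max_right _ _)) hN₀
  have hNR1 : (1 : ℝ) ≤ N := by exact_mod_cast le_trans (by norm_num) hN2
  have hNR0 : (0 : ℝ) < N := by linarith
  have hm0 : (0 : ℝ) < m := by exact_mod_cast hm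
  -- the common size `X = m^{1/2} N^{-1+ε} ≥ 0`, and `N^{-2} ≤ N^{-1+ε}`
  set X : ℝ := (m : ℝ) ^ (1 / 2 : ℝ) * (N : ℝ) ^ (-1 + ε) with hX_def
  have hX0 : 0 ≤ X := mul_nonneg (Real.rpow_nonneg hm0.le _) (Real.rpow_nonneg hNR0.le _)
  have hN2ε : (N : ℝ) ^ (-(2 : ℝ)) ≤ (N : ℝ) ^ (-1 + ε) :=
    Real.rpow_le_rpow_of_exponent_le hNR1 (by linarith)
  by_cases hcase : (N : ℝ) ^ B ≤ m
  · -- the regime `m ≥ N^B`: stub 6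
    have h := H₆ N hN hN₆ m hcase
    calc _ ≤ C₆ * (m : ℝ) ^ (1 / 2 : ℝ) * (N : ℝ) ^ (-1 + ε) := h
      _ = C₆ * X := by rw [hX_def]; ring
      _ ≤ max C₆ (2 * Real.pi + |C₄| + |C₅|) * X :=
          mul_le_mul_of_nonneg_right (le_max_left _ _) hX0
      _ = _ := by rw [hX_def]; ring
  · -- the regime `1 ≤ m ≤ N^B`
    have hmB : (m : ℝ) ≤ (N : ℝ) ^ B := (not_le.mp hcase).le
    set y : ℝ := 1 / ((m : ℝ) * (N : ℝ) ^ 2) with hy_def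
    have hy : 0 < y := by rw [hy_def]; positivity
    have hyN : 1 / ((N : ℝ) * y) = (m : ℝ) * N := by
      rw [hy_def]; field_simp
    -- the weight `w(n) = n^{-1/2} e^{-2π n y}`
    set w : ℕ → ℂ := fun n ↦
      (((n : ℝ) ^ (-(1 / 2 : ℝ)) * Real.exp (-(2 * Real.pi * n) * y) : ℝ) : ℂ) with hw_def
    have hw0 : w 0 = 0 := by
      simp only [hw_def, Nat.cast_zero]
      rw [Real.zero_rpow (by norm_num : (-(1 / 2 : ℝ)) ≠ 0), zero_mul, Complex.ofReal_zero]
    -- Step 1: the exact AFE inside the harmonic sum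
    have hfin := finite_newforms0_holds N 2
    have step1 : GL2Family.harmonicSum N 2
          (fun f ↦ GL2Family.heckeLambda f m * IwaniecSarnak.centralValue f) =
        GL2Family.harmonicSum N 2
            (fun f ↦ GL2Family.heckeLambda f m * dampedTwist f (fun _ ↦ 1) y) -
          GL2Family.harmonicSum N 2
            (fun f ↦ frickeEigenvalue f * GL2Family.heckeLambda f m *
              dampedTwist f (fun _ ↦ 1) ((m : ℝ) * N)) := by
      unfold GL2Family.harmonicSum
      rw [← finsum_mem_sub_distrib _ _ hfin]
      refine finsum_mem_congr rfl fun f hf ↦ ?_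
      beta_reduce
      rw [h1 N f hf y hy, hyN]
      ring
    -- Step 2: through the `n`-series
    obtain ⟨hsumP, step2⟩ := h2 N m y hy
    -- Step 3: Petersson, `pet = δ − petJ` termwise against the weight
    set P : ℕ → ℂ := fun n ↦ w n * KowalskiMichel2000.pet N m n with hP_def
    set Q : ℕ → ℂ := fun n ↦ w n * KowalskiMichel2000.petJ N m n with hQ_def
    set D : ℕ → ℂ := fun n ↦ if n = m then w m else 0 with hD_def
    have hPDQ : ∀ n, P n = D n - Q n := by
      intro n
      rcases Nat.eq_zero_or_pos n with rfl | hn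
      · simp only [hP_def, hQ_def, hD_def, hw0, zero_mul]
        have : (0 : ℕ) ≠ m := by omega
        rw [if_neg this, sub_zero]
      · have hpet := (h3 N hN m n hm hn).2
        simp only [hP_def, hQ_def, hD_def]
        rw [hpet, mul_sub]
        congr 1
        by_cases hnm : n = m
        · subst hnm; simp
        · rw [if_neg hnm, if_neg (Ne.symm hnm), mul_zero]
    have hDsum : HasSum D (w m) := by
      simpa [hD_def] using hasSum_ite_eq m (w m)
    have hPsum : Summable P := Summable.of_norm hsumP
    have hQsum : Summable Q := by
      have : Q = fun n ↦ D n - P n := by funext n; rw [hPDQ]; ring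
      rw [this]
      exact hDsum.summable.sub hPsum
    have step3 : ∑' n : ℕ, P n = w m - ∑' n : ℕ, Q n := by
      rw [tsum_congr hPDQ, hDsum.summable.tsum_sub hQsum, hDsum.tsum_eq]
    -- the three estimates
    have hE4 : ‖∑' n : ℕ, Q n‖ ≤ |C₄| * X := by
      have h := H₄ N hN hN₄ m hm hmB
      refine h.trans ?_
      rw [hX_def, ← mul_assoc]
      exact mul_le_mul_of_nonneg_right (mul_le_mul_of_nonneg_right (le_abs_self _)
        (Real.rpow_nonneg hm0.le _)) (Real.rpow_nonneg hNR0.le _)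
    have hE5 : ‖GL2Family.harmonicSum N 2
        (fun f ↦ frickeEigenvalue f * GL2Family.heckeLambda f m *
          dampedTwist f (fun _ ↦ 1) ((m : ℝ) * N))‖ ≤ |C₅| * X := by
      have h := H₅ N hN hN₅ m hm
      refine h.trans ?_
      calc C₅ * (m : ℝ) ^ (1 / 2 : ℝ) * (N : ℝ) ^ (-(2 : ℝ))
          ≤ |C₅| * (m : ℝ) ^ (1 / 2 : ℝ) * (N : ℝ) ^ (-(2 : ℝ)) :=
            mul_le_mul_of_nonneg_right (mul_le_mul_of_nonneg_right (le_abs_self _)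
              (Real.rpow_nonneg hm0.le _)) (Real.rpow_nonneg hNR0.le _)
        _ ≤ |C₅| * (m : ℝ) ^ (1 / 2 : ℝ) * (N : ℝ) ^ (-1 + ε) :=
            mul_le_mul_of_nonneg_left hN2ε (mul_nonneg (abs_nonneg _) (Real.rpow_nonneg hm0.le _))
        _ = |C₅| * X := by rw [hX_def]; ring
    have hEd : ‖w m - (((m : ℝ) ^ (-(1 / 2 : ℝ)) : ℝ) : ℂ)‖ ≤ 2 * Real.pi * X := by
      have h := norm_diag_sub_le hm hy.le
      refine h.trans ?_
      -- `2π m^{1/2} y = 2π m^{-1/2} N^{-2} ≤ 2π m^{1/2} N^{-2} ≤ 2π X`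
      have hy_le : y ≤ (N : ℝ) ^ (-(2 : ℝ)) := by
        rw [hy_def, Real.rpow_neg hNR0.le, show ((2 : ℝ)) = ((2 : ℕ) : ℝ) by norm_num,
          Real.rpow_natCast, one_div]
        have hm1 : (1 : ℝ) ≤ m := by exact_mod_cast hm
        have hN2pos : (0 : ℝ) < (N : ℝ) ^ 2 := by positivity
        rw [inv_le_inv₀ (by positivity) hN2pos]
        nlinarith
      calc 2 * Real.pi * (m : ℝ) ^ (1 / 2 : ℝ) * y
          ≤ 2 * Real.pi * (m : ℝ) ^ (1 / 2 : ℝ) * (N : ℝ) ^ (-(2 : ℝ)) := by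
            gcongr
        _ ≤ 2 * Real.pi * (m : ℝ) ^ (1 / 2 : ℝ) * (N : ℝ) ^ (-1 + ε) := by
            gcongr
        _ = 2 * Real.pi * X := by rw [hX_def]; ring
    -- assemble
    rw [step1, step2]
    change ‖∑' n : ℕ, P n - _ - _‖ ≤ _
    rw [step3]
    set Dual := GL2Family.harmonicSum N 2
        (fun f ↦ frickeEigenvalue f * GL2Family.heckeLambda f m *
          dampedTwist f (fun _ ↦ 1) ((m : ℝ) * N)) with hDual
    calc ‖w m - ∑' n : ℕ, Q n - Dual - (((m : ℝ) ^ (-(1 / 2 : ℝ)) : ℝ) : ℂ)‖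
        = ‖(w m - (((m : ℝ) ^ (-(1 / 2 : ℝ)) : ℝ) : ℂ)) - ∑' n : ℕ, Q n - Dual‖ := by ring_nf
      _ ≤ ‖w m - (((m : ℝ) ^ (-(1 / 2 : ℝ)) : ℝ) : ℂ)‖ + ‖∑' n : ℕ, Q n‖ + ‖Dual‖ := by
          refine (norm_sub_le _ _).trans ?_
          gcongr
          exact norm_sub_le _ _
      _ ≤ 2 * Real.pi * X + |C₄| * X + |C₅| * X := by gcongr
      _ = (2 * Real.pi + |C₄| + |C₅|) * X := by ring
      _ ≤ max C₆ (2 * Real.pi + |C₄| + |C₅|) * X :=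
          mul_le_mul_of_nonneg_right (le_max_right _ _) hX0
      _ = _ := by rw [hX_def]; ring

/-- **The fact from the stubs** (audit target: concludes `bettin2017_theorem11_primeLevel` BY NAME).
[cite: Bettin2017, Thm. 1.1] -/
theorem bettin2017_theorem11_primeLevel_of_stubs : bettin2017_theorem11_primeLevel :=
  bettin2017_theorem11_primeLevel_of stub_centralValue_eq_dampedTwist_sub
    stub_harmonicSum_dampedTwist stub_petersson stub_offDiagonal stub_dualTail stub_largeShift

end Literature.NumberTheory.LFunctions.Bettin2017

/-! ## The crux BY NAME (route `PrimeLevelFamEdge`, item stmt-Parity-20345) -/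

/-- **The crux `FirstMomentPrinted` of route `PrimeLevelFamEdge` (stmt-Parity-20345) from the stubs.**
`FirstMomentPrinted` is the literal alias of `bettin2017_theorem11_primeLevel`; after p618506 and p621287
(I1 landed) there is NO `sorry` behind this theorem; the Theorems-side closer of record is
`Summit.Parity.GeneralizedHardyLittlewood.Theorems.FirstMomentPrinted_proof` (p621700).
[cite: Bettin2017, Thm. 1.1] -/
theorem Summit.Parity.GeneralizedHardyLittlewood.Cruxes.FirstMomentPrinted.FirstMomentPrinted_proof :
    Summit.Parity.GeneralizedHardyLittlewood.Theses.PrimeLevelFamEdge.FirstMomentPrinted :=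
  Literature.NumberTheory.LFunctions.Bettin2017.bettin2017_theorem11_primeLevel_of_stubs

end
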